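import Summits.NavierStokesRegularity.OSWSelfSimilar.SheetRPerturbedResolventIdentityC
import Summits.NavierStokesRegularity.OSWSelfSimilar.SheetROddClass
import Literature.Analysis.OperatorTheory.PseudoResolventOperator
import HarnessLib

/-!
# SHEET-ℝ frame, (P1) for the FULL operator `A = (−∂² + d∂ + V) + K`: on the ODD CLASS the resolvent `R_K(σ)` is an INJECTIVE
# pseudo-resolvent, hence THE resolvent of a CLOSED operator — the KERNEL CAVEAT of `SheetRPerturbedResolvent(C)` discharged

HONEST FRAMING (cell ns-blowup GROUP B / zone Z3, case Z3-SR-SPEC, PAPER item (P1) «`(A_F + σJ)⁻¹J` exists as a bounded operator on `L²_w`,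
analytic on `Re σ > −(c₁ + γ)`» and the resolvent-keyed eigenvalue dictionary of `Literature…PseudoResolventRankOneEigenvalue`; 1-D MODEL
certificate frame (viscous gCLM/OSW sheet on the line); not Euler/NS; «violates: none — MODEL»). Nothing here asserts that a profile exists;
the Gårding datum of the perturbed form ((S1), interval arithmetic) is the HYPOTHESIS `GardingDataKC`; `K : Esp L hL →L[ℝ] W L` is an arbitrary
bounded real operator (cert-1: `K = −P + F`).

The files `SheetRPerturbedResolventC` / `…IdentityC` construct `R_K(σ) = resolventKC hL K h σ : L²_w(ℂ) →L[ℂ] L²_w(ℂ)` on `Re σ > −m` with the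
first resolvent identity; because the weak formulation tests against ODD functions, `R_K(σ)` annihilates even data and is only a
pseudo-resolvent on all of `L²_w(ℂ)`.  Here (with `SheetROddClass`):

* `resolventKC_mem_Wcodd` — `R_K(σ)` takes values in the odd class `Wcodd L`;
* `resolventOdd hL K h σ : Wcodd L →L[ℂ] Wcodd L` — its restriction–corestriction; `isPseudoResolvent_resolventOdd` on `{Re σ > −m}`,
  `differentiableOn_resolventOdd`, `norm_resolventOdd_le_inv` (`‖R(σ)G‖ ≤ ‖G‖/(m + Re σ)`);
* **`injective_resolventOdd`** — on the odd class `R_K(σ)` is injective (`Re σ > −m`): `R_K(σ)G = 0` forces the weak data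
  `∫ w (Re G) v = ∫ w (Im G) v = 0` for every odd test, and the density lemma `SheetROddClass.eq_zero_of_mem_Wcodd` gives `G = 0`;
* **`generatorOdd hL K h σ₀ hσ₀ := operatorOfResolvent (resolventOdd hL K h) σ₀ _`** — Kato's closed operator `T` with
  `R_K(σ) = (σ − T)⁻¹` for EVERY `σ` in the half-plane (`isClosed_generatorOdd`, `generatorOdd_resolventOdd`, `resolventOdd_generatorOdd`);
  in the cell's notation `T = −A_F` restricted to the odd class, `D(T) = Ran R_K(σ₀)`.  This is the object on which the resolvent-keyed
  sentences `eigen_rankOne_iff` / `algebraicallySimple_of_analyticOrderAt_eq_one` of `PseudoResolventRankOneEigenvalue` are stated.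
Two definitions (`resolventOdd`, `generatorOdd`); no named fact.  WHAT THIS IS NOT: not NS; not the spectral certificate; no number of record moves.
-/

noncomputable section

namespace Summit.NavierStokesRegularity.OSWSelfSimilar
namespace SheetRResolventOddClass

open _root_.MeasureTheory _root_.Set _root_.Filter _root_.Real SheetRWeakProfilePV SheetRWeakToStrong SheetREnergyClass SheetRWeightedMeasure
  SheetRLinearisedTests SheetREnergySpace SheetRTestSpace SheetRLinearisedFormBounds SheetRSolutionOperator SheetRLinearisedCutoffEnergy
  SheetRResolventPair SheetRComplexPivot SheetRResolventComplex SheetRResolventIdentity SheetRPerturbedUniqueness SheetRPerturbedPair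
  SheetRPerturbedResolventC SheetRPerturbedResolventIdentityC SheetROddClass Literature.Analysis.OperatorTheory
open scoped Topology ENNReal

variable {L D₀ D₁ V₀ c m : ℝ} {d V : ℝ → ℝ}

/-! ### §1 The resolvent takes values in the odd class; restriction -/

/-- `R_K(σ)G ∈ Wcodd L` for every `G` (inside the half-plane it is `ofPair (ιE p_R, ιE p_I)` with odd profiles; outside it is `0`). [folklore] -/
theorem resolventKC_mem_Wcodd (hL : 0 < L) (K : Esp L hL →L[ℝ] W L) (h : GardingDataKC L hL d V K D₀ D₁ V₀ c m) (σ : ℂ) (G : Wc L) :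
    resolventKC hL K h σ G ∈ Wcodd L := by
  by_cases hσ : -m < σ.re
  · obtain ⟨happ, -, -, -⟩ := resolventKC_weak hL K h hσ G
    rw [happ]
    exact ofPair_ιpair_mem_Wcodd hL _
  · rw [resolventKC_apply, resolventRKC_of_not hL K h hσ]
    exact (Wcodd L).zero_mem

/-- **The resolvent on the odd class**: restriction–corestriction of `R_K(σ)` to `Wcodd L`. [folklore] -/
def resolventOdd (hL : 0 < L) (K : Esp L hL →L[ℝ] W L) (h : GardingDataKC L hL d V K D₀ D₁ V₀ c m) (σ : ℂ) :
    Wcodd L →L[ℂ] Wcodd L :=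
  ((resolventKC hL K h σ).comp (Wcodd L).subtypeL).codRestrict (Wcodd L) fun G => resolventKC_mem_Wcodd hL K h σ (G : Wc L)

/-- `resolventOdd σ G = R_K(σ) G` as elements of `L²_w(ℂ)`. [folklore] -/
theorem coe_resolventOdd (hL : 0 < L) (K : Esp L hL →L[ℝ] W L) (h : GardingDataKC L hL d V K D₀ D₁ V₀ c m) (σ : ℂ) (G : Wcodd L) :
    ((resolventOdd hL K h σ G : Wcodd L) : Wc L) = resolventKC hL K h σ (G : Wc L) := rfl

/-- **Pseudo-resolvent on the odd class**: the resolvent identity restricts. [folklore] -/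
theorem isPseudoResolvent_resolventOdd (hL : 0 < L) (K : Esp L hL →L[ℝ] W L) (h : GardingDataKC L hL d V K D₀ D₁ V₀ c m) :
    IsPseudoResolvent {σ : ℂ | -m < σ.re} (resolventOdd hL K h) := by
  intro z hz w hw
  refine ContinuousLinearMap.ext fun G => Subtype.ext ?_
  show (((resolventOdd hL K h z G - resolventOdd hL K h w G : Wcodd L)) : Wc L) =
    ((((w - z) • resolventOdd hL K h z (resolventOdd hL K h w G)) : Wcodd L) : Wc L)
  rw [Submodule.coe_sub, Submodule.coe_smul, coe_resolventOdd, coe_resolventOdd, coe_resolventOdd, coe_resolventOdd]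
  exact resolventKC_sub hL K h hz hw (G : Wc L)

/-- Holomorphy of `σ ↦ resolventOdd σ` on the half-plane. [folklore] -/
theorem differentiableOn_resolventOdd (hL : 0 < L) (K : Esp L hL →L[ℝ] W L) (h : GardingDataKC L hL d V K D₀ D₁ V₀ c m) :
    DifferentiableOn ℂ (resolventOdd hL K h) {σ : ℂ | -m < σ.re} := by
  haveI : CompleteSpace (Wcodd L) := completeSpace_Wcodd L
  exact IsPseudoResolvent.differentiableOn (A := Wcodd L →L[ℂ] Wcodd L) (isPseudoResolvent_resolventOdd hL K h) (isOpen_halfPlane m)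

/-- The sharp pivot bound restricts: `‖resolventOdd σ G‖ ≤ ‖G‖/(m + Re σ)`. [folklore] -/
theorem norm_resolventOdd_le_inv (hL : 0 < L) (K : Esp L hL →L[ℝ] W L) (h : GardingDataKC L hL d V K D₀ D₁ V₀ c m) {σ : ℂ}
    (hσ : -m < σ.re) (G : Wcodd L) : ‖resolventOdd hL K h σ G‖ ≤ ‖G‖ / (m + σ.re) :=
  norm_resolventKC_le_inv hL K h hσ (G : Wc L)

/-! ### §2 Injectivity on the odd class -/

/-- The pivot embedding `ιE` is injective: `ιE p = 0 ⇒ p = 0`. [folklore] -/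
theorem eq_zero_of_ιE_eq_zero (hL : 0 < L) {p : Esp L hL} (hp : ιE hL p = 0) : p = 0 := by
  obtain ⟨hu', -, hu₁m', h0', h1', -, -⟩ := energyClass_of_mem hL p
  have hu : ∀ x, prim (der p) x = prim (der p) 0 + ∫ s in (0 : ℝ)..x, der p s := hu'
  have hu₁m : AEStronglyMeasurable (der p) volume := hu₁m'
  have h0 : Integrable fun y => (L ^ 2 + y ^ 2) * prim (der p) y ^ 2 := h0'
  have h1 : Integrable fun y => (L ^ 2 + y ^ 2) * der p y ^ 2 := h1'
  obtain ⟨huc, -, -, -, -⟩ := basic_of_primitive hL hu hu₁m h0 h1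
  have hs : Real.sqrt (∫ ξ, (L ^ 2 + ξ ^ 2) * prim (der p) ξ ^ 2) = 0 := by
    rw [← (norm_ιE_le hL p).1, hp, norm_zero]
  have hI : (∫ ξ, (L ^ 2 + ξ ^ 2) * prim (der p) ξ ^ 2) = 0 :=
    (Real.sqrt_eq_zero (integral_nonneg fun ξ => by positivity)).1 hs
  have hz := eq_zero_of_weightedSq_eq_zero hL huc h0 hI
  exact ext_of_prim_eq hL fun x => by rw [hz x, prim_der_zero hL]

/-- The left-hand sides of the pair system at the zero profile vanish. [folklore] -/
theorem lhs_zero (hL : 0 < L) (K : Esp L hL →L[ℝ] W L) (h : GardingDataKC L hL d V K D₀ D₁ V₀ c m) (s t : ℝ) (v v₁ : ℝ → ℝ)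
    (hv : IsCompactTest v v₁) :
    linForm L d (fun ξ => V ξ + s) (prim (der (0 : Esp L hL))) (der (0 : Esp L hL)) v v₁
        + (∫ y, (L ^ 2 + y ^ 2) * (((K (0 : Esp L hL) : W L) : ℝ → ℝ) y * v y))
        - t * ∫ y, (L ^ 2 + y ^ 2) * (prim (der (0 : Esp L hL)) y * v y) = 0 ∧
      linForm L d (fun ξ => V ξ + s) (prim (der (0 : Esp L hL))) (der (0 : Esp L hL)) v v₁
        + (∫ y, (L ^ 2 + y ^ 2) * (((K (0 : Esp L hL) : W L) : ℝ → ℝ) y * v y))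
        + t * ∫ y, (L ^ 2 + y ^ 2) * (prim (der (0 : Esp L hL)) y * v y) = 0 := by
  have e1 := lhs_eqKC hL K h s t (0 : Esp L hL) (0 : Esp L hL) v v₁ hv
  have hR : Eform hL h.d_meas (shift_hypsKC h s).1 h.D₁_nonneg h.d_le (shift_hypsKC h s).2 (0 : Esp L hL) ⟨(v, v₁), hv⟩
      + Pdata hL (K (0 : Esp L hL)) ⟨(v, v₁), hv⟩ - t * Bcpl hL (0 : Esp L hL) ⟨(v, v₁), hv⟩ = 0 := by
    simp only [map_zero, LinearMap.zero_apply, mul_zero, add_zero, sub_zero]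
  have hB : ∫ y, (L ^ 2 + y ^ 2) * (prim (der (0 : Esp L hL)) y * v y) = 0 := by simp [prim_der_zero hL]
  have e := e1.trans hR
  rw [hB, mul_zero, sub_zero] at e
  rw [hB, mul_zero, sub_zero, add_zero]
  exact ⟨e, e⟩

/-- **Injectivity of `R_K(σ)` on the odd class** (`Re σ > −m`). [folklore] -/
theorem injective_resolventOdd (hL : 0 < L) (K : Esp L hL →L[ℝ] W L) (h : GardingDataKC L hL d V K D₀ D₁ V₀ c m) {σ : ℂ}
    (hσ : -m < σ.re) : Function.Injective (resolventOdd hL K h σ) := by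
  refine (injective_iff_map_eq_zero (resolventOdd hL K h σ)).2 fun G hG => ?_
  have h0 : resolventKC hL K h σ (G : Wc L) = 0 := by
    rw [← coe_resolventOdd hL K h σ G, hG, Submodule.coe_zero]
  obtain ⟨happ, -, -, hweak⟩ := resolventKC_weak hL K h hσ (G : Wc L)
  set P := pairOpKC hL K h σ hσ (toPair L (G : Wc L)) with hP
  have hι : ιpair hL P = 0 := by rw [← toPair_ofPair (ιpair hL P), ← happ, h0, map_zero]
  obtain ⟨hι1, hι2⟩ := ιpair_fst_snd hL P
  have hPf : P.fst = 0 := eq_zero_of_ιE_eq_zero hL (by rw [← hι1, hι, WithLp.zero_fst])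
  have hPs : P.snd = 0 := eq_zero_of_ιE_eq_zero hL (by rw [← hι2, hι, WithLp.zero_snd])
  obtain ⟨hGf, hGs⟩ := toPair_fst_snd (G : Wc L)
  have hre : ∀ v v₁ : ℝ → ℝ, IsCompactTest v v₁ → ∫ y, (L ^ 2 + y ^ 2) * (((reW L (G : Wc L) : W L) : ℝ → ℝ) y * v y) = 0 := by
    intro v v₁ hv
    have e := (hweak v v₁ hv).1
    rw [hPf, hPs, (lhs_zero hL K h σ.re σ.im v v₁ hv).1] at e
    exact e.symm
  have him : ∀ v v₁ : ℝ → ℝ, IsCompactTest v v₁ → ∫ y, (L ^ 2 + y ^ 2) * (((imW L (G : Wc L) : W L) : ℝ → ℝ) y * v y) = 0 := by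
    intro v v₁ hv
    have e := (hweak v v₁ hv).2
    rw [hPf, hPs, (lhs_zero hL K h σ.re σ.im v v₁ hv).2] at e
    exact e.symm
  exact Subtype.ext (eq_zero_of_mem_Wcodd hL G.2 hre him)

/-! ### §3 The closed operator on the odd class whose resolvent is `R_K(σ)` -/

/-- **The closed operator behind `R_K` on the odd class** (Kato VIII-§1.1): `T := operatorOfResolvent (resolventOdd hL K h) σ₀ _`,
domain `Ran R_K(σ₀)`, `T(R_K(σ₀)G) = σ₀R_K(σ₀)G − G`; in the cell's notation `T = −A_F|odd`. [folklore] -/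
def generatorOdd (hL : 0 < L) (K : Esp L hL →L[ℝ] W L) (h : GardingDataKC L hL d V K D₀ D₁ V₀ c m) (σ₀ : ℂ) (hσ₀ : -m < σ₀.re) :
    Wcodd L →ₗ.[ℂ] Wcodd L :=
  operatorOfResolvent (resolventOdd hL K h) σ₀ (injective_resolventOdd hL K h hσ₀)

/-- `T` is a closed operator. [folklore] -/
theorem isClosed_generatorOdd (hL : 0 < L) (K : Esp L hL →L[ℝ] W L) (h : GardingDataKC L hL d V K D₀ D₁ V₀ c m) (σ₀ : ℂ)
    (hσ₀ : -m < σ₀.re) : (generatorOdd hL K h σ₀ hσ₀).IsClosed :=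
  isClosed_operatorOfResolvent

/-- The domain of `T` is `Ran R_K(σ₀)` (on the odd class). [folklore] -/
theorem generatorOdd_domain (hL : 0 < L) (K : Esp L hL →L[ℝ] W L) (h : GardingDataKC L hL d V K D₀ D₁ V₀ c m) (σ₀ : ℂ)
    (hσ₀ : -m < σ₀.re) :
    (generatorOdd hL K h σ₀ hσ₀).domain = LinearMap.range (resolventOdd hL K h σ₀ : Wcodd L →ₗ[ℂ] Wcodd L) :=
  operatorOfResolvent_domain

/-- `R_K(σ)G` lies in the domain of `T` for every `σ` in the half-plane. [folklore] -/
theorem resolventOdd_mem_domain (hL : 0 < L) (K : Esp L hL →L[ℝ] W L) (h : GardingDataKC L hL d V K D₀ D₁ V₀ c m) {σ₀ σ : ℂ}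
    (hσ₀ : -m < σ₀.re) (hσ : -m < σ.re) (G : Wcodd L) : resolventOdd hL K h σ G ∈ (generatorOdd hL K h σ₀ hσ₀).domain :=
  (isPseudoResolvent_resolventOdd hL K h).apply_mem_domain_of_mem hσ₀ hσ G

/-- **`(σ − T) R_K(σ) = 1`** on the odd class, for every `σ` with `Re σ > −m`: `T(R_K(σ)G) = σR_K(σ)G − G`. [folklore] -/
theorem generatorOdd_resolventOdd (hL : 0 < L) (K : Esp L hL →L[ℝ] W L) (h : GardingDataKC L hL d V K D₀ D₁ V₀ c m) {σ₀ σ : ℂ}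
    (hσ₀ : -m < σ₀.re) (hσ : -m < σ.re) (G : Wcodd L) :
    generatorOdd hL K h σ₀ hσ₀ ⟨resolventOdd hL K h σ G, resolventOdd_mem_domain hL K h hσ₀ hσ G⟩ = σ • resolventOdd hL K h σ G - G :=
  (isPseudoResolvent_resolventOdd hL K h).apply_resolvent_of_mem hσ₀ hσ G

/-- **`R_K(σ)(σ − T) = 1` on `D(T)`**, for every `σ` with `Re σ > −m`. [folklore] -/
theorem resolventOdd_generatorOdd (hL : 0 < L) (K : Esp L hL →L[ℝ] W L) (h : GardingDataKC L hL d V K D₀ D₁ V₀ c m) {σ₀ σ : ℂ}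
    (hσ₀ : -m < σ₀.re) (hσ : -m < σ.re) {u : Wcodd L} (hu : u ∈ (generatorOdd hL K h σ₀ hσ₀).domain) :
    resolventOdd hL K h σ (σ • u - generatorOdd hL K h σ₀ hσ₀ ⟨u, hu⟩) = u :=
  (isPseudoResolvent_resolventOdd hL K h).resolvent_apply_sub hσ₀ hσ hu

/-- **Eigenvalues of `T` read off from the resolvent**: for `σ` in the half-plane and `σ ≠ μ`, `u` is an eigenvector of `T` with
eigenvalue `μ` iff `R_K(σ)u = (σ − μ)⁻¹u`. [folklore] -/
theorem eigen_generatorOdd_iff (hL : 0 < L) (K : Esp L hL →L[ℝ] W L) (h : GardingDataKC L hL d V K D₀ D₁ V₀ c m) {σ₀ σ μ : ℂ}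
    (hσ₀ : -m < σ₀.re) (hσ : -m < σ.re) (hσμ : σ ≠ μ) (u : Wcodd L) :
    (∃ hu : u ∈ (generatorOdd hL K h σ₀ hσ₀).domain, generatorOdd hL K h σ₀ hσ₀ ⟨u, hu⟩ = μ • u) ↔
      resolventOdd hL K h σ u = (σ - μ)⁻¹ • u :=
  (isPseudoResolvent_resolventOdd hL K h).eigen_iff_apply_eq_inv_smul hσ₀ hσ hσμ u

end SheetRResolventOddClass
end Summit.NavierStokesRegularity.OSWSelfSimilar

end
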